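import Literature.Topology.FourManifolds.SchoenfliesStepSweep
import Literature.Topology.FourManifolds.SchoenfliesStepTube
import Literature.Topology.FourManifolds.SchoenfliesSphereThreeProofs
import Literature.Topology.FourManifolds.HeightDistinctCriticalValues
import Literature.Topology.FourManifolds.StepDiscs
import Literature.Topology.FourManifolds.MorseAffine
import HarnessLib

/-!
# Alexander's theorem: the induction on saddles, and `schoenflies_exists_ball` holds

Topic `Literature/Topology/FourManifolds`; the last file of the fact seat of Alexander's theorem
(`provefact-Literature.Topology.FourManifolds.SphereEmbedding.schoenflies_exists_ball`, Schultens
(2014), Thm. 3.2.5: "any 2-sphere in `ℝ³` bounds a 3-ball"), written under a take-the-blocker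
claim from the Cerf seat (`Literature.Topology.FourManifolds.cerf_pi0DiffDisc_relBoundary_three`,
Cerf (1968) Ch. III).  **Everything in this file is proved; no definitions, no named facts.**
It discharges the named fact `Literature.Topology.FourManifolds.SphereEmbedding.schoenflies_exists_ball`
(`SchoenfliesSphereThree.lean`) as `SphereEmbedding.schoenflies_exists_ball_holds`.

The printed proof (PDF pp. 43–45): isotope `S` so that the height is Morse ("We isotope `S` so
that the height function … restricts to a Morse function"; here: choose a generic direction,
`HeightFunction.exists_mem_isMorse_and_injOn_height_sphere`, and shear it to the vertical); induct
on the number `n` of saddles; `n ≤ 1`: the sphere bounds a ball by the exp-height device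
(`ExpHeight.exists_isSmoothEmbedding_image_sphere_of_ncard_index_one_le_one`); `n ≥ 2`: cut along
an innermost circle of a regular level `H'` separating two saddles, smooth and absorb one of
the two capped discs (the inductive step, assembled in `SchoenfliesStepTube.lean`,
`SchoenfliesStepSubsphere.lean`, `SchoenfliesStepSweep.lean` from the fact seat's normal-form
machinery).  The printed "both `S₁` and `S₂` have fewer saddles" is only true when both discs
carry saddles; in general the absorbed disc may carry none, and then the number of level
circles in `H'` drops instead — so the induction is lexicographic in
`(#saddles, #components of S ∩ H')` for a fixed `H'` with saddles on both sides (§3).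

* §1 reflecting a configuration in tube normal form (the discs swap);
* §2 `SchoenfliesInduction.exists_stepData` — the data of the step for a chosen labelling of the
  discs; `SchoenfliesInduction.step` — **the inductive step**: from a configuration at the level
  `0` with `n` saddles (and the theorem for `< n` saddles) to a configuration with fewer
  saddles, or with the same saddles and fewer level circles, whose bounding ball pulls back;
* §3 `SchoenfliesInduction.exists_ball_of_config` — the double induction;
* §4 `SchoenfliesInduction.exists_ball_euclidean` — every smoothly embedded `𝕊² → ℝ³` is
  `e(∂𝔻³)` for a smooth embedding `e : ℝ³ → ℝ³`; `SphereEmbedding.schoenflies_exists_ball_holds`.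

## References
* J. Schultens, *Introduction to 3-Manifolds*, GSM 151, AMS (2014), Thm. 3.2.5 and its proof
  (PDF pp. 43–45), Cor. 3.2.6.
* J. W. Alexander, *On the subdivision of 3-space by a polyhedron*, PNAS 10 (1924), 6–8.
* J. Cerf, *Sur les difféomorphismes de la sphère de dimension trois (Γ₄ = 0)*, LNM 53 (1968),
  Ch. III.
-/

noncomputable section

open Set Metric Filter Topology Function Module
open scoped ContDiff RealInnerProductSpace Manifold

namespace Literature.Topology.FourManifolds.SchoenfliesInduction

open CappedBallLid SchoenfliesConfig SweepFace SchoenfliesStep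

/-! ### §1 Reflecting a configuration in tube normal form -/

section Reflect

variable {G : EuclideanSpace ℝ (Fin 3) → ℝ}
  {f : sphere (0 : EuclideanSpace ℝ (Fin 3)) 1 → EuclideanSpace ℝ (Fin 3)} {σ w₀ η₀ : ℝ}
  {Dup Dlow : Set (EuclideanSpace ℝ (Fin 3))}

/-- For an involution, images are preimages. [folklore] -/
theorem image_eq_preimage_of_involutive' {X : Type*} {R : X → X} (hR : ∀ x, R (R x) = x) (S : Set X) :
    R '' S = R ⁻¹' S := by
  ext x; constructor
  · rintro ⟨z, hz, rfl⟩; show R (R z) ∈ S; rw [hR]; exact hz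
  · intro hx; exact ⟨R x, hx, hR x⟩

/-- **Reflecting the discs.**  If `(D₊, D₋)` satisfy the conclusions of `StepDiscs.exists_discs`
for the sphere `f` (tube of widths `w₀, η₀`), then `(R D₋, R D₊)` satisfy them for `R ∘ f`,
`R` the reflection `x₂ ↦ -x₂`. [folklore] -/
theorem discs_reflect
    (R : EuclideanSpace ℝ (Fin 3) ≃ₘ⟮𝓘(ℝ, EuclideanSpace ℝ (Fin 3)), 𝓘(ℝ, EuclideanSpace ℝ (Fin 3))⟯
      EuclideanSpace ℝ (Fin 3))
    (hRh : ∀ x, hsq (R x) = hsq x) (hR2 : ∀ x, (R x) 2 = -x 2) (hRR : ∀ x, R (R x) = x)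
    (hDupc : IsClosed Dup) (hDlowc : IsClosed Dlow) (hUnion : Dup ∪ Dlow = range f)
    (hInter : Dup ∩ Dlow = {x | hsq x = 1 ∧ x 2 = 0})
    (hcUp : IsPreconnected (Dup \ {x | hsq x = 1 ∧ x 2 = 0}))
    (hcLow : IsPreconnected (Dlow \ {x | hsq x = 1 ∧ x 2 = 0}))
    (hUpBox : ∀ x ∈ Dup, hsq x ≤ (1 + 3 * w₀) ^ 2 → |x 2| ≤ η₀ → 0 ≤ x 2)
    (hLowBox : ∀ x ∈ Dlow, hsq x ≤ (1 + 3 * w₀) ^ 2 → |x 2| ≤ η₀ → x 2 ≤ 0)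
    (hUpMem : ∀ p ∈ range f, hsq p ≤ (1 + 3 * w₀) ^ 2 → |p 2| ≤ η₀ → 0 < p 2 → p ∈ Dup)
    (hLowMem : ∀ p ∈ range f, hsq p ≤ (1 + 3 * w₀) ^ 2 → |p 2| ≤ η₀ → p 2 < 0 → p ∈ Dlow) :
    IsClosed (R '' Dlow) ∧ IsClosed (R '' Dup) ∧ R '' Dlow ∪ R '' Dup = range (R ∘ f) ∧
    R '' Dlow ∩ R '' Dup = {x | hsq x = 1 ∧ x 2 = 0} ∧
    IsPreconnected (R '' Dlow \ {x | hsq x = 1 ∧ x 2 = 0}) ∧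
    IsPreconnected (R '' Dup \ {x | hsq x = 1 ∧ x 2 = 0}) ∧
    (∀ x ∈ R '' Dlow, hsq x ≤ (1 + 3 * w₀) ^ 2 → |x 2| ≤ η₀ → 0 ≤ x 2) ∧
    (∀ x ∈ R '' Dup, hsq x ≤ (1 + 3 * w₀) ^ 2 → |x 2| ≤ η₀ → x 2 ≤ 0) ∧
    (∀ p ∈ range (R ∘ f), hsq p ≤ (1 + 3 * w₀) ^ 2 → |p 2| ≤ η₀ → 0 < p 2 → p ∈ R '' Dlow) ∧
    (∀ p ∈ range (R ∘ f), hsq p ≤ (1 + 3 * w₀) ^ 2 → |p 2| ≤ η₀ → p 2 < 0 → p ∈ R '' Dup) := by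
  have hcirc : R '' {x | hsq x = 1 ∧ x 2 = 0} = {x | hsq x = 1 ∧ x 2 = 0} := by
    rw [image_eq_preimage_of_involutive' hRR]
    ext x; simp only [mem_preimage, mem_setOf_eq, hRh, hR2, neg_eq_zero]
  have himg : ∀ S : Set (EuclideanSpace ℝ (Fin 3)), R '' S = R ⁻¹' S := image_eq_preimage_of_involutive' hRR
  have hRinj : Injective (R : EuclideanSpace ℝ (Fin 3) → EuclideanSpace ℝ (Fin 3)) := R.injective
  refine ⟨?_, ?_, ?_, ?_, ?_, ?_, ?_, ?_, ?_, ?_⟩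
  · rw [himg]; exact hDlowc.preimage R.continuous
  · rw [himg]; exact hDupc.preimage R.continuous
  · rw [← image_union, union_comm, hUnion, range_comp]
  · rw [← image_inter hRinj, inter_comm, hInter, hcirc]
  · rw [← hcirc, ← image_sdiff hRinj]; exact hcLow.image _ R.continuous.continuousOn
  · rw [← hcirc, ← image_sdiff hRinj]; exact hcUp.image _ R.continuous.continuousOn
  · rintro _ ⟨z, hz, rfl⟩ h1 h2
    rw [hRh] at h1; rw [hR2] at h2 ⊢
    have := hLowBox z hz h1 (by rwa [abs_neg] at h2); linarith
  · rintro _ ⟨z, hz, rfl⟩ h1 h2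
    rw [hRh] at h1; rw [hR2] at h2 ⊢
    have := hUpBox z hz h1 (by rwa [abs_neg] at h2); linarith
  · rintro p hp h1 h2 h3
    rw [range_comp, himg] at hp
    refine ⟨R p, hLowMem (R p) hp (by rw [hRh]; exact h1) (by rw [hR2, abs_neg]; exact h2) (by rw [hR2]; linarith), hRR p⟩
  · rintro p hp h1 h2 h3
    rw [range_comp, himg] at hp
    refine ⟨R p, hUpMem (R p) hp (by rw [hRh]; exact h1) (by rw [hR2, abs_neg]; exact h2) (by rw [hR2]; linarith), hRR p⟩

/-- **Reflecting a configuration in tube normal form**: `(G ∘ R, R ∘ f)` is again a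
configuration in tube normal form with the same sign and widths; its height is the negative of
the old one, so critical points, saddles and the injectivity of the height on the critical set
are unchanged, maxima and minima are exchanged, and the level-`0` set is reflected.
[cite: Schultens2014, proof of Thm. 3.2.5 (PDF p. 45)] -/
theorem config_reflect (hC : Config G f)
    (hNF : ∀ x, hsq x ≤ (1 + 3 * w₀) ^ 2 → |x 2| ≤ η₀ → G x = σ * (hsq x - 1))
    (R : EuclideanSpace ℝ (Fin 3) ≃ₘ⟮𝓘(ℝ, EuclideanSpace ℝ (Fin 3)), 𝓘(ℝ, EuclideanSpace ℝ (Fin 3))⟯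
      EuclideanSpace ℝ (Fin 3))
    (hRA : HeightAffine R (-1) 0) (hRh : ∀ x, hsq (R x) = hsq x) (hR2 : ∀ x, (R x) 2 = -x 2)
    (hRR : ∀ x, R (R x) = x) :
    Config (G ∘ R) (R ∘ f) ∧
    (∀ x, hsq x ≤ (1 + 3 * w₀) ^ 2 → |x 2| ≤ η₀ → (G ∘ R) x = σ * (hsq x - 1)) ∧
    height (R ∘ f) = (fun y => -height f y) ∧
    criticalSet (𝓡 2) (height (R ∘ f)) = criticalSet (𝓡 2) (height f) ∧
    criticalSetOfIndex (𝓡 2) (height (R ∘ f)) 1 = criticalSetOfIndex (𝓡 2) (height f) 1 ∧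
    range (R ∘ f) ∩ {x | x 2 = 0} = R '' (range f ∩ {x | x 2 = 0}) := by
  have hsymm : ∀ x, R.symm x = R x := fun x =>
    calc R.symm x = R (R (R.symm x)) := (hRR _).symm
      _ = R x := by rw [R.apply_symm_apply]
  have hRinj : Injective (R : EuclideanSpace ℝ (Fin 3) → EuclideanSpace ℝ (Fin 3)) := R.injective
  have hGR : G ∘ R.symm = G ∘ R := by funext x; simp [hsymm]
  have hC' : Config (G ∘ R) (R ∘ f) := by rw [← hGR]; exact hC.transport R hRA
  have hh : height (R ∘ f) = fun y => -height f y := by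
    rw [height_comp_eq (f := f) R hRA]; funext y; ring
  refine ⟨hC', fun x h1 h2 => ?_, hh, ?_, ?_, ?_⟩
  · simp only [Function.comp_apply]
    rw [hNF (R x) (by rw [hRh]; exact h1) (by rw [hR2, abs_neg]; exact h2), hRh]
  · rw [hh, show (fun y => -height f y) = fun y => (-1) * height f y + 0 from funext fun y => by ring]
    exact criticalSet_const_mul_add (by norm_num) 0 (hC.morse.contMDiff.mdifferentiable (by simp))
  · rw [hh, show (fun y => -height f y) = fun y => (-1) * height f y + 0 from funext fun y => by ring]
    exact (isMorse_affine hC.morse (Or.inr rfl) 0).2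
  · rw [range_comp, image_inter hRinj]
    congr 1
    rw [image_eq_preimage_of_involutive' hRR]
    ext x; simp only [mem_preimage, mem_setOf_eq, hR2, neg_eq_zero]

end Reflect

/-! ### §2 The inductive step -/

section Step

variable {G : EuclideanSpace ℝ (Fin 3) → ℝ}
  {f : sphere (0 : EuclideanSpace ℝ (Fin 3)) 1 → EuclideanSpace ℝ (Fin 3)} {σ w₀ η₀ : ℝ}
  {Dup Dlow : Set (EuclideanSpace ℝ (Fin 3))}

/-- **The data of the step** for a configuration in tube normal form and a labelling
`(D₊, D₋)` of its discs (kept, absorbed): an admissible profile, scales `s, δ` (the apex height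
`s` and the bowl height `3s/8` off a given finite set `Λ`), the solid function and its normal
form `StepNF F_X (D₊ ∪ T₀) D₋`, the collar fill `Φ`, and the sub-sphere `W` parametrised by a
smooth embedding `f_B`. [cite: Schultens2014, proof of Thm. 3.2.5 (PDF p. 45)] -/
theorem exists_stepData (hC : Config G f) (hσ : σ = 1 ∨ σ = -1) (hw₀ : 0 < w₀) (hη₀ : 0 < η₀)
    (hNF : ∀ x, hsq x ≤ (1 + 3 * w₀) ^ 2 → |x 2| ≤ η₀ → G x = σ * (hsq x - 1))
    (hDupc : IsClosed Dup) (hDlowc : IsClosed Dlow) (hUnion : Dup ∪ Dlow = range f)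
    (hInter : Dup ∩ Dlow = {x | hsq x = 1 ∧ x 2 = 0})
    (hUpBox : ∀ x ∈ Dup, hsq x ≤ (1 + 3 * w₀) ^ 2 → |x 2| ≤ η₀ → 0 ≤ x 2)
    (hLowBox : ∀ x ∈ Dlow, hsq x ≤ (1 + 3 * w₀) ^ 2 → |x 2| ≤ η₀ → x 2 ≤ 0)
    {Λ : Set ℝ} (hΛ : Λ.Finite) :
    ∃ (P : ℝ → ℝ) (s δ ε₁ R₁ : ℝ) (FX : EuclideanSpace ℝ (Fin 3) → ℝ) (T₀ : Set (EuclideanSpace ℝ (Fin 3)))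
      (Φ : EuclideanSpace ℝ (Fin 3) ≃ₘ⟮𝓘(ℝ, EuclideanSpace ℝ (Fin 3)), 𝓘(ℝ, EuclideanSpace ℝ (Fin 3))⟯ EuclideanSpace ℝ (Fin 3))
      (fB : sphere (0 : EuclideanSpace ℝ (Fin 3)) 1 → EuclideanSpace ℝ (Fin 3)),
      Admissible P ∧ StepNF FX (Dup ∪ T₀) Dlow w₀ η₀ ε₁ ∧ StepScale s δ w₀ η₀ ∧ δ < ε₁ ∧ s ∉ Λ ∧ 3 * s / 8 ∉ Λ ∧
      (∀ y, FX (f y) = 0) ∧ {x | FX x = 0} = range f ∪ T₀ ∧ 0 < R₁ ∧ (∀ x ∈ T₀, R₁ ≤ ‖x‖) ∧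
      (∀ x ∈ T₀, x ∉ range f) ∧ range f ⊆ ball 0 R₁ ∧
      {x | hsq x ≤ (1 + 3 * w₀) ^ 2 ∧ |x 2| ≤ η₀} ⊆ ball 0 R₁ ∧
      Φ '' {x | FX x = 0} = {x | fillFun FX P s δ ((1 + s) ^ 2 + ε₁ + 2) x = 0} ∧
      (∀ x, x ∉ closedBox s → Φ x = x) ∧
      Manifold.IsSmoothEmbedding (𝓡 2) 𝓘(ℝ, EuclideanSpace ℝ (Fin 3)) ∞ fB ∧
      range fB = subSphere FX P (Dup ∪ T₀) s δ ε₁ := by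
  obtain ⟨P, hP⟩ := Admissible.exists
  obtain ⟨FX, T₀, R₁, ε₁, hN, hfZ, hZ, hT₀c, hR₁, hT₀far, hT₀range, hrangeR, htubeR⟩ :=
    exists_stepNF hC hσ hw₀ hη₀ hNF hDupc hDlowc hUnion hInter hUpBox hLowBox
  obtain ⟨s, hs, hs1, hsw, hsη, -, hsΛ, hs38Λ⟩ := exists_scale hw₀ hη₀ one_pos hΛ
  obtain ⟨δ₀, hδ₀, hδ₀ε, hfill⟩ := exists_collarFill hP hN hs hs1 hsw hsη
  obtain ⟨hS, Φ, -, hΦZ, hΦid⟩ := hfill δ₀ hδ₀ le_rfl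
  have hE₂R : Dlow ⊆ ball 0 R₁ := fun x hx => hrangeR (hUnion ▸ Or.inr hx)
  obtain ⟨-, hZ₁, hZ₂, hTW, hTu⟩ := fill_bookkeeping hP hN hS hfZ hZ hT₀far htubeR hE₂R Φ hΦZ hΦid
  obtain ⟨fB, hfB, hWB⟩ := exists_subsphereParam hP hN hS (hC.emb.diffeomorph_comp Φ) hZ₁ hZ₂ hTW hTu
  exact ⟨P, s, δ₀, ε₁, R₁, FX, T₀, Φ, fB, hP, hN, hS, hδ₀ε, hsΛ, hs38Λ, hfZ, hZ, hR₁, hT₀far, hT₀range, hrangeR,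
    htubeR, hΦZ, hΦid, hfB, hWB⟩

/-- **The wall**: in tube normal form the sphere meets the tube exactly in the unit cylinder.
[folklore] -/
theorem wall_of_tubeNF (hC : Config G f) (hσ : σ = 1 ∨ σ = -1)
    (hNF : ∀ x, hsq x ≤ (1 + 3 * w₀) ^ 2 → |x 2| ≤ η₀ → G x = σ * (hsq x - 1)) :
    ∀ x : EuclideanSpace ℝ (Fin 3), hsq x ≤ (1 + 3 * w₀) ^ 2 → |x 2| ≤ η₀ → (x ∈ range f ↔ hsq x = 1) := by
  intro x h1 h2
  have hσ0 : σ ≠ 0 := by rcases hσ with rfl | rfl <;> norm_num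
  rw [hC.range_eq, mem_setOf_eq, hNF x h1 h2]
  constructor
  · intro h
    rcases mul_eq_zero.1 h with h | h
    · exact absurd h hσ0
    · linarith
  · intro h; rw [h]; ring

/-- In tube normal form the maximum of the height is at least `η₀` and the minimum at most
`-η₀` (the wall points `(1, 0, ±η₀)` lie on the sphere). [folklore] -/
theorem eta_le_height_of_isMaxOn (hw₀ : 0 < w₀) (hη₀ : 0 < η₀)
    (hwall : ∀ x : EuclideanSpace ℝ (Fin 3), hsq x ≤ (1 + 3 * w₀) ^ 2 → |x 2| ≤ η₀ → (x ∈ range f ↔ hsq x = 1))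
    {y₀ : sphere (0 : EuclideanSpace ℝ (Fin 3)) 1} (hmax : IsMaxOn (height f) univ y₀) : η₀ ≤ height f y₀ := by
  obtain ⟨y, hy⟩ := wallPoint_mem hw₀ hwall (t := η₀) (by rw [abs_of_pos hη₀])
  have h := hmax (mem_univ y)
  simp only [mem_setOf_eq, height_apply] at h
  rw [hy, (wallPoint_coords η₀).2] at h
  rw [height_apply]; exact h

/-- The same for the minimum. [folklore] -/
theorem height_le_neg_eta_of_isMinOn (hw₀ : 0 < w₀) (hη₀ : 0 < η₀)
    (hwall : ∀ x : EuclideanSpace ℝ (Fin 3), hsq x ≤ (1 + 3 * w₀) ^ 2 → |x 2| ≤ η₀ → (x ∈ range f ↔ hsq x = 1))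
    {y₀ : sphere (0 : EuclideanSpace ℝ (Fin 3)) 1} (hmin : IsMinOn (height f) univ y₀) : height f y₀ ≤ -η₀ := by
  obtain ⟨y, hy⟩ := wallPoint_mem hw₀ hwall (t := -η₀) (by rw [abs_neg, abs_of_pos hη₀])
  have h := hmin (mem_univ y)
  simp only [mem_setOf_eq, height_apply] at h
  rw [hy, (wallPoint_coords (-η₀)).2] at h
  rw [height_apply]; exact h

set_option maxHeartbeats 3200000 in
/-- **The oriented step.**  For a configuration `f` in tube normal form with `n ≥ 1` saddles,
height injective on the critical set and without critical points at height `0`, and a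
labelling `(D₊, D₋)` of its discs such that fewer than `n` saddles lie over `D₋` and a global
extremum of the height lies over `D₊`: assuming Alexander's theorem for configurations with
fewer than `n` saddles, the sub-sphere bounds a ball, the ball is swept away, and the swept
sphere `f' = Θ ∘ f` is a configuration with either fewer saddles, or the same saddles (with the
same heights) and fewer level circles at height `0`; and a bounding ball for `f'` pulls back to
one for `f`. [cite: Schultens2014, proof of Thm. 3.2.5 (PDF p. 45)] -/
theorem step_oriented {n : ℕ}
    (IH : ∀ (F' : EuclideanSpace ℝ (Fin 3) → ℝ) (f' : sphere (0 : EuclideanSpace ℝ (Fin 3)) 1 → EuclideanSpace ℝ (Fin 3)),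
      Config F' f' → InjOn (height f') (criticalSet (𝓡 2) (height f')) → saddles f' < n →
        ∃ e : EuclideanSpace ℝ (Fin 3) → EuclideanSpace ℝ (Fin 3),
          Manifold.IsSmoothEmbedding 𝓘(ℝ, EuclideanSpace ℝ (Fin 3)) 𝓘(ℝ, EuclideanSpace ℝ (Fin 3)) ∞ e ∧
            e '' sphere 0 1 = range f')
    (hC : Config G f) (hσ : σ = 1 ∨ σ = -1) (hw₀ : 0 < w₀) (hη₀ : 0 < η₀)
    (hNF : ∀ x, hsq x ≤ (1 + 3 * w₀) ^ 2 → |x 2| ≤ η₀ → G x = σ * (hsq x - 1))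
    (hDupc : IsClosed Dup) (hDlowc : IsClosed Dlow) (hUnion : Dup ∪ Dlow = range f)
    (hInter : Dup ∩ Dlow = {x | hsq x = 1 ∧ x 2 = 0})
    (hcUp : IsPreconnected (Dup \ {x | hsq x = 1 ∧ x 2 = 0}))
    (hUpBox : ∀ x ∈ Dup, hsq x ≤ (1 + 3 * w₀) ^ 2 → |x 2| ≤ η₀ → 0 ≤ x 2)
    (hLowBox : ∀ x ∈ Dlow, hsq x ≤ (1 + 3 * w₀) ^ 2 → |x 2| ≤ η₀ → x 2 ≤ 0)
    (hUpMem : ∀ p ∈ range f, hsq p ≤ (1 + 3 * w₀) ^ 2 → |p 2| ≤ η₀ → 0 < p 2 → p ∈ Dup)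
    (hinj : InjOn (height f) (criticalSet (𝓡 2) (height f)))
    (h0 : ∀ y, IsMCriticalPt (𝓡 2) (height f) y → height f y ≠ 0)
    (hsad : saddles f = n)
    (hkL : {y | y ∈ criticalSetOfIndex (𝓡 2) (height f) 1 ∧ f y ∈ Dlow}.ncard < n)
    (hext0 : (∃ y₀, IsMaxOn (height f) univ y₀ ∧ f y₀ ∈ Dup) ∨ (∃ y₀, IsMinOn (height f) univ y₀ ∧ f y₀ ∈ Dup)) :
    ∃ (F' : EuclideanSpace ℝ (Fin 3) → ℝ) (f' : sphere (0 : EuclideanSpace ℝ (Fin 3)) 1 → EuclideanSpace ℝ (Fin 3)),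
      Config F' f' ∧ InjOn (height f') (criticalSet (𝓡 2) (height f')) ∧
      (∀ y, IsMCriticalPt (𝓡 2) (height f') y → height f' y ≠ 0) ∧
      ((∃ e : EuclideanSpace ℝ (Fin 3) → EuclideanSpace ℝ (Fin 3),
          Manifold.IsSmoothEmbedding 𝓘(ℝ, EuclideanSpace ℝ (Fin 3)) 𝓘(ℝ, EuclideanSpace ℝ (Fin 3)) ∞ e ∧
            e '' sphere 0 1 = range f') →
        ∃ e : EuclideanSpace ℝ (Fin 3) → EuclideanSpace ℝ (Fin 3),
          Manifold.IsSmoothEmbedding 𝓘(ℝ, EuclideanSpace ℝ (Fin 3)) 𝓘(ℝ, EuclideanSpace ℝ (Fin 3)) ∞ e ∧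
            e '' sphere 0 1 = range f) ∧
      (saddles f' < n ∨
        (criticalSetOfIndex (𝓡 2) (height f') 1 = criticalSetOfIndex (𝓡 2) (height f) 1 ∧
          (∀ y ∈ criticalSetOfIndex (𝓡 2) (height f) 1, height f' y = height f y) ∧
          {C : Set (EuclideanSpace ℝ (Fin 3)) | ∃ x ∈ range f' ∩ {x | x 2 = 0},
              C = connectedComponentIn (range f' ∩ {x | x 2 = 0}) x}.ncard <
            {C : Set (EuclideanSpace ℝ (Fin 3)) | ∃ x ∈ range f ∩ {x | x 2 = 0},
              C = connectedComponentIn (range f ∩ {x | x 2 = 0}) x}.ncard)) := by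
  have hwall := wall_of_tubeNF hC hσ hNF
  -- forbidden values for the scale: the critical values
  have hfin : (criticalSet (𝓡 2) (height f)).Finite := IsMorse.finite_criticalSet_holds hC.morse
  obtain ⟨P, s, δ, ε₁, R₁, FX, T₀, Φ, -, hP, hN, hS, hδε, hsΛ, hs38Λ, hfZ, hZ, hR₁, hT₀far, hT₀range, hrangeR, htubeR,
      hΦZ, hΦid, -, -⟩ :=
    exists_stepData hC hσ hw₀ hη₀ hNF hDupc hDlowc hUnion hInter hUpBox hLowBox (hfin.image (height f))
  obtain ⟨hs, hs1, hsw, hsη, hδ, hδs⟩ := scales hS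
  -- the certification point
  have hext : ∃ q ∈ Dup, q ∉ closedBox s ∧
      ((s < q 2 ∧ ∀ p ∈ Dlow, p ∉ closedBox s → p 2 < q 2) ∨
        (q 2 < -(6 * s) ∧ ∀ p ∈ Dlow, p ∉ closedBox s → q 2 < p 2)) := by
    rcases hext0 with ⟨y₀, hy₀, hy₀U⟩ | ⟨y₀, hy₀, hy₀U⟩
    · exact hext_of_isMaxOn hw₀ hη₀ hs hsη hwall hUnion hInter hinj hy₀ hy₀U
    · exact hext_of_isMinOn hw₀ hη₀ hs hsη hwall hUnion hInter hinj hy₀ hy₀U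
  -- the sub-configuration and the induction hypothesis
  obtain ⟨FB, fB, hCB, hrangeW, hFBW, hBsub, hco, hface⟩ :=
    exists_subConfig hP hN hS hC.emb hfZ hZ hR₁ hT₀far hrangeR htubeR hUnion hcUp hUpMem hC.morse Φ hΦZ hΦid hext
  have hE₂ : Dlow ⊆ range f := fun x hx => hUnion ▸ Or.inr hx
  have hsadB : saddles fB < n := by
    rw [saddles_sub_eq hP hN hS hC.emb hfZ hE₂ hCB.emb hrangeW hC.morse]; exact hkL
  have hinjB : InjOn (height fB) (criticalSet (𝓡 2) (height fB)) :=
    injOn_height_sub hP hN hS hC.emb hfZ hE₂ hCB.emb hrangeW hinj fun y' hy' hv => hsΛ ⟨y', hy', hv⟩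
  obtain ⟨eB, heB, heBS⟩ := IH FB fB hCB hinjB hsadB
  -- the sweep
  obtain ⟨Θ, FU, hFUs, hZU, hregU, hMorseU, hclassU, hgermU, hsaddleU, hlevelU⟩ :=
    exists_swept hP hN hS hδε hC.emb hfZ hZ hT₀far hT₀range hrangeR htubeR hUnion hC.morse Φ hΦZ hΦid hCB hrangeW
      hBsub hco hface heB heBS
  obtain ⟨F', hC'⟩ := exists_config_of_isMorse (hC.emb.diffeomorph_comp Θ) hMorseU
  refine ⟨F', Θ ∘ f, hC', ?_, ?_, fun h => exists_ball_of_diffeomorph_comp Θ h, ?_⟩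
  · -- injectivity of the height on the critical set
    intro y₁ hy₁ y₂ hy₂ heq
    rcases hclassU y₁ hy₁ with ⟨hc₁, -, hΘ₁, hg₁⟩ | ⟨hΘ₁, hv₁, -⟩ <;>
      rcases hclassU y₂ hy₂ with ⟨hc₂, -, hΘ₂, hg₂⟩ | ⟨hΘ₂, hv₂, -⟩
    · exact hinj hc₁ hc₂ (by rw [← hg₁.self_of_nhds, ← hg₂.self_of_nhds]; exact heq)
    · exfalso; apply hs38Λ
      exact ⟨y₁, hc₁, by rw [← hg₁.self_of_nhds, show height (Θ ∘ f) y₁ = height (Θ ∘ f) y₂ from heq, hv₂]⟩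
    · exfalso; apply hs38Λ
      exact ⟨y₂, hc₂, by rw [← hg₂.self_of_nhds, ← show height (Θ ∘ f) y₁ = height (Θ ∘ f) y₂ from heq, hv₁]⟩
    · apply (hC.emb.diffeomorph_comp Θ).isEmbedding.injective
      show Θ (f y₁) = Θ (f y₂)
      rw [hΘ₁, hΘ₂]
  · -- no critical point at height `0`
    intro y hy
    rcases hclassU y hy with ⟨hc, -, -, hg⟩ | ⟨-, hv, -⟩
    · rw [hg.self_of_nhds]; exact h0 y hc
    · rw [hv]; positivity
  · -- the dichotomy
    have hS1fin : (criticalSetOfIndex (𝓡 2) (height f) 1).Finite := hfin.subset (criticalSetOfIndex_subset _ _ _)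
    have hsplit : criticalSetOfIndex (𝓡 2) (height f) 1 =
        {y | y ∈ criticalSetOfIndex (𝓡 2) (height f) 1 ∧ f y ∈ Dlow} ∪
          {y | y ∈ criticalSetOfIndex (𝓡 2) (height f) 1 ∧ f y ∉ Dlow} := by
      ext y; simp only [mem_union, mem_setOf_eq]; tauto
    have hdisj : Disjoint {y | y ∈ criticalSetOfIndex (𝓡 2) (height f) 1 ∧ f y ∈ Dlow}
        {y | y ∈ criticalSetOfIndex (𝓡 2) (height f) 1 ∧ f y ∉ Dlow} := by
      rw [Set.disjoint_left]; rintro y ⟨-, h1⟩ ⟨-, h2⟩; exact h2 h1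
    have hsum := Set.ncard_union_eq hdisj (hS1fin.subset fun y hy => hy.1) (hS1fin.subset fun y hy => hy.1)
    rw [← hsplit] at hsum
    have hsadU : saddles (Θ ∘ f) = {y | y ∈ criticalSetOfIndex (𝓡 2) (height f) 1 ∧ f y ∉ Dlow}.ncard := by
      unfold saddles; rw [hsaddleU]
    unfold saddles at hsad
    by_cases hA : {y | y ∈ criticalSetOfIndex (𝓡 2) (height f) 1 ∧ f y ∈ Dlow}.ncard = 0
    · right
      have hAempty : {y | y ∈ criticalSetOfIndex (𝓡 2) (height f) 1 ∧ f y ∈ Dlow} = ∅ :=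
        (Set.ncard_eq_zero (hS1fin.subset fun y hy => hy.1)).1 hA
      have hSeq : criticalSetOfIndex (𝓡 2) (height (Θ ∘ f)) 1 = criticalSetOfIndex (𝓡 2) (height f) 1 := by
        rw [hsaddleU]
        conv_rhs => rw [hsplit, hAempty, empty_union]
      refine ⟨hSeq, fun y hy => ?_, ?_⟩
      · have hyD : f y ∉ Dlow := fun hyD => by
          have : y ∈ ({y | y ∈ criticalSetOfIndex (𝓡 2) (height f) 1 ∧ f y ∈ Dlow} : Set _) := ⟨hy, hyD⟩
          rw [hAempty] at this; exact this
        exact (hgermU y hy.1 hyD).2.self_of_nhds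
      · rw [hlevelU]
        exact ncard_components_level_lt hw₀ hη₀ hs hsw hwall hDupc hDlowc hUnion hInter (finite_components_level hC h0)
    · left
      rw [hsadU]; omega

set_option maxHeartbeats 3200000 in
/-- **The inductive step** (see the module docstring).  Given Alexander's theorem for
configurations with fewer than `n ≥ 1` saddles, a configuration with `n` saddles, height
injective on the critical set, no critical point at height `0` and a sphere meeting the plane
`{x₂ = 0}` is reduced to a configuration with fewer saddles — or with the same saddles, on the
same sides of the plane, and fewer level circles — whose bounding ball pulls back.  The two
discs of the innermost level circle are labelled by the **orientation test**
(`SchoenfliesStep.false_of_extrema_over_absorbed`), reflecting the picture in the plane if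
necessary. [cite: Schultens2014, proof of Thm. 3.2.5 (PDF p. 45)] -/
theorem step {n : ℕ} (hn : 1 ≤ n)
    (IH : ∀ (F' : EuclideanSpace ℝ (Fin 3) → ℝ) (f' : sphere (0 : EuclideanSpace ℝ (Fin 3)) 1 → EuclideanSpace ℝ (Fin 3)),
      Config F' f' → InjOn (height f') (criticalSet (𝓡 2) (height f')) → saddles f' < n →
        ∃ e : EuclideanSpace ℝ (Fin 3) → EuclideanSpace ℝ (Fin 3),
          Manifold.IsSmoothEmbedding 𝓘(ℝ, EuclideanSpace ℝ (Fin 3)) 𝓘(ℝ, EuclideanSpace ℝ (Fin 3)) ∞ e ∧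
            e '' sphere 0 1 = range f')
    {F : EuclideanSpace ℝ (Fin 3) → ℝ} {f : sphere (0 : EuclideanSpace ℝ (Fin 3)) 1 → EuclideanSpace ℝ (Fin 3)}
    (hC : Config F f) (hinj : InjOn (height f) (criticalSet (𝓡 2) (height f)))
    (h0 : ∀ y, IsMCriticalPt (𝓡 2) (height f) y → height f y ≠ 0) (hne : ∃ y, height f y = 0)
    (hsad : saddles f = n)
    (hbelow : ∃ y ∈ criticalSetOfIndex (𝓡 2) (height f) 1, height f y < 0)
    (habove : ∃ y ∈ criticalSetOfIndex (𝓡 2) (height f) 1, 0 < height f y) :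
    ∃ (F' : EuclideanSpace ℝ (Fin 3) → ℝ) (f' : sphere (0 : EuclideanSpace ℝ (Fin 3)) 1 → EuclideanSpace ℝ (Fin 3)),
      Config F' f' ∧ InjOn (height f') (criticalSet (𝓡 2) (height f')) ∧
      (∀ y, IsMCriticalPt (𝓡 2) (height f') y → height f' y ≠ 0) ∧
      ((∃ e : EuclideanSpace ℝ (Fin 3) → EuclideanSpace ℝ (Fin 3),
          Manifold.IsSmoothEmbedding 𝓘(ℝ, EuclideanSpace ℝ (Fin 3)) 𝓘(ℝ, EuclideanSpace ℝ (Fin 3)) ∞ e ∧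
            e '' sphere 0 1 = range f') →
        ∃ e : EuclideanSpace ℝ (Fin 3) → EuclideanSpace ℝ (Fin 3),
          Manifold.IsSmoothEmbedding 𝓘(ℝ, EuclideanSpace ℝ (Fin 3)) 𝓘(ℝ, EuclideanSpace ℝ (Fin 3)) ∞ e ∧
            e '' sphere 0 1 = range f) ∧
      (saddles f' < n ∨
        (saddles f' = n ∧ (∃ y ∈ criticalSetOfIndex (𝓡 2) (height f') 1, height f' y < 0) ∧
          (∃ y ∈ criticalSetOfIndex (𝓡 2) (height f') 1, 0 < height f' y) ∧
          {C : Set (EuclideanSpace ℝ (Fin 3)) | ∃ x ∈ range f' ∩ {x | x 2 = 0},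
              C = connectedComponentIn (range f' ∩ {x | x 2 = 0}) x}.ncard <
            {C : Set (EuclideanSpace ℝ (Fin 3)) | ∃ x ∈ range f ∩ {x | x 2 = 0},
              C = connectedComponentIn (range f ∩ {x | x 2 = 0}) x}.ncard)) := by
  -- Step 0: the tube normal form `f₁ = Θ ∘ f`
  obtain ⟨Θ, G, σ, w₀, η₀, Ψh, hC₁, hσ, hw₀, hη₀, hNF, hcrit₁, hgerm₁, hlev₁⟩ := exists_tubeNF hC h0 hne
  have hval₁ : ∀ y, IsMCriticalPt (𝓡 2) (height f) y → height (Θ ∘ f) y = height f y :=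
    fun y hy => (hgerm₁ y hy).self_of_nhds
  have hS1₁ : criticalSetOfIndex (𝓡 2) (height (Θ ∘ f)) 1 = criticalSetOfIndex (𝓡 2) (height f) 1 := by
    ext y; constructor
    · rintro ⟨hy, h1⟩
      have hy' := (hcrit₁ y).1 hy
      exact ⟨hy', by rw [← morseIndex_congr_of_eventuallyEq (hgerm₁ y hy')]; exact h1⟩
    · rintro ⟨hy, h1⟩
      exact ⟨(hcrit₁ y).2 hy, by rw [morseIndex_congr_of_eventuallyEq (hgerm₁ y hy)]; exact h1⟩
  have hinj₁ : InjOn (height (Θ ∘ f)) (criticalSet (𝓡 2) (height (Θ ∘ f))) := by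
    intro y₁ hy₁ y₂ hy₂ heq
    have h₁ := (hcrit₁ y₁).1 hy₁; have h₂ := (hcrit₁ y₂).1 hy₂
    exact hinj h₁ h₂ (by rw [← hval₁ y₁ h₁, ← hval₁ y₂ h₂]; exact heq)
  have h0₁ : ∀ y, IsMCriticalPt (𝓡 2) (height (Θ ∘ f)) y → height (Θ ∘ f) y ≠ 0 := fun y hy => by
    have h := (hcrit₁ y).1 hy; rw [hval₁ y h]; exact h0 y h
  have hsad₁ : saddles (Θ ∘ f) = n := by unfold saddles at hsad ⊢; rw [hS1₁]; exact hsad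
  have hcomp₁ : {C : Set (EuclideanSpace ℝ (Fin 3)) | ∃ x ∈ range (Θ ∘ f) ∩ {x | x 2 = 0},
      C = connectedComponentIn (range (Θ ∘ f) ∩ {x | x 2 = 0}) x}.ncard =
      {C : Set (EuclideanSpace ℝ (Fin 3)) | ∃ x ∈ range f ∩ {x | x 2 = 0},
        C = connectedComponentIn (range f ∩ {x | x 2 = 0}) x}.ncard := by
    rw [hlev₁]; exact SphereMoves.ncard_components_image Ψh _
  have hwall := wall_of_tubeNF hC₁ hσ hNF
  -- pulling conclusions back from `f₁` to `f`
  have pull : ∀ (F' : EuclideanSpace ℝ (Fin 3) → ℝ) (f' : sphere (0 : EuclideanSpace ℝ (Fin 3)) 1 → EuclideanSpace ℝ (Fin 3))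
      (g : sphere (0 : EuclideanSpace ℝ (Fin 3)) 1 → EuclideanSpace ℝ (Fin 3)) (ε : ℝ),
      (ε = 1 ∨ ε = -1) →
      criticalSetOfIndex (𝓡 2) (height g) 1 = criticalSetOfIndex (𝓡 2) (height f) 1 →
      (∀ y ∈ criticalSetOfIndex (𝓡 2) (height f) 1, height g y = ε * height f y) →
      {C : Set (EuclideanSpace ℝ (Fin 3)) | ∃ x ∈ range g ∩ {x | x 2 = 0},
          C = connectedComponentIn (range g ∩ {x | x 2 = 0}) x}.ncard =
        {C : Set (EuclideanSpace ℝ (Fin 3)) | ∃ x ∈ range f ∩ {x | x 2 = 0},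
          C = connectedComponentIn (range f ∩ {x | x 2 = 0}) x}.ncard →
      ((∃ e : EuclideanSpace ℝ (Fin 3) → EuclideanSpace ℝ (Fin 3),
          Manifold.IsSmoothEmbedding 𝓘(ℝ, EuclideanSpace ℝ (Fin 3)) 𝓘(ℝ, EuclideanSpace ℝ (Fin 3)) ∞ e ∧
            e '' sphere 0 1 = range g) →
        ∃ e : EuclideanSpace ℝ (Fin 3) → EuclideanSpace ℝ (Fin 3),
          Manifold.IsSmoothEmbedding 𝓘(ℝ, EuclideanSpace ℝ (Fin 3)) 𝓘(ℝ, EuclideanSpace ℝ (Fin 3)) ∞ e ∧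
            e '' sphere 0 1 = range f) →
      (Config F' f' ∧ InjOn (height f') (criticalSet (𝓡 2) (height f')) ∧
        (∀ y, IsMCriticalPt (𝓡 2) (height f') y → height f' y ≠ 0) ∧
        ((∃ e : EuclideanSpace ℝ (Fin 3) → EuclideanSpace ℝ (Fin 3),
            Manifold.IsSmoothEmbedding 𝓘(ℝ, EuclideanSpace ℝ (Fin 3)) 𝓘(ℝ, EuclideanSpace ℝ (Fin 3)) ∞ e ∧
              e '' sphere 0 1 = range f') →
          ∃ e : EuclideanSpace ℝ (Fin 3) → EuclideanSpace ℝ (Fin 3),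
            Manifold.IsSmoothEmbedding 𝓘(ℝ, EuclideanSpace ℝ (Fin 3)) 𝓘(ℝ, EuclideanSpace ℝ (Fin 3)) ∞ e ∧
              e '' sphere 0 1 = range g) ∧
        (saddles f' < n ∨
          (criticalSetOfIndex (𝓡 2) (height f') 1 = criticalSetOfIndex (𝓡 2) (height g) 1 ∧
            (∀ y ∈ criticalSetOfIndex (𝓡 2) (height g) 1, height f' y = height g y) ∧
            {C : Set (EuclideanSpace ℝ (Fin 3)) | ∃ x ∈ range f' ∩ {x | x 2 = 0},
                C = connectedComponentIn (range f' ∩ {x | x 2 = 0}) x}.ncard <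
              {C : Set (EuclideanSpace ℝ (Fin 3)) | ∃ x ∈ range g ∩ {x | x 2 = 0},
                C = connectedComponentIn (range g ∩ {x | x 2 = 0}) x}.ncard))) →
      ∃ (F' : EuclideanSpace ℝ (Fin 3) → ℝ) (f' : sphere (0 : EuclideanSpace ℝ (Fin 3)) 1 → EuclideanSpace ℝ (Fin 3)),
        Config F' f' ∧ InjOn (height f') (criticalSet (𝓡 2) (height f')) ∧
        (∀ y, IsMCriticalPt (𝓡 2) (height f') y → height f' y ≠ 0) ∧
        ((∃ e : EuclideanSpace ℝ (Fin 3) → EuclideanSpace ℝ (Fin 3),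
            Manifold.IsSmoothEmbedding 𝓘(ℝ, EuclideanSpace ℝ (Fin 3)) 𝓘(ℝ, EuclideanSpace ℝ (Fin 3)) ∞ e ∧
              e '' sphere 0 1 = range f') →
          ∃ e : EuclideanSpace ℝ (Fin 3) → EuclideanSpace ℝ (Fin 3),
            Manifold.IsSmoothEmbedding 𝓘(ℝ, EuclideanSpace ℝ (Fin 3)) 𝓘(ℝ, EuclideanSpace ℝ (Fin 3)) ∞ e ∧
              e '' sphere 0 1 = range f) ∧
        (saddles f' < n ∨
          (saddles f' = n ∧ (∃ y ∈ criticalSetOfIndex (𝓡 2) (height f') 1, height f' y < 0) ∧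
            (∃ y ∈ criticalSetOfIndex (𝓡 2) (height f') 1, 0 < height f' y) ∧
            {C : Set (EuclideanSpace ℝ (Fin 3)) | ∃ x ∈ range f' ∩ {x | x 2 = 0},
                C = connectedComponentIn (range f' ∩ {x | x 2 = 0}) x}.ncard <
              {C : Set (EuclideanSpace ℝ (Fin 3)) | ∃ x ∈ range f ∩ {x | x 2 = 0},
                C = connectedComponentIn (range f ∩ {x | x 2 = 0}) x}.ncard)) := by
    intro F' f' g ε hε hS1g hvalg hcompg hpullg ⟨hC', hinj', h0', hred, hdich⟩
    refine ⟨F', f', hC', hinj', h0', fun h => hpullg (hred h), ?_⟩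
    rcases hdich with h | ⟨hS1', hval', hlt⟩
    · exact Or.inl h
    · right
      refine ⟨by unfold saddles at hsad ⊢; rw [hS1', hS1g]; exact hsad, ?_, ?_, by rw [← hcompg]; exact hlt⟩
      · rcases hε with rfl | rfl
        · obtain ⟨y, hy, hlt0⟩ := hbelow
          exact ⟨y, by rw [hS1', hS1g]; exact hy, by rw [hval' y (hS1g ▸ hy), hvalg y hy]; linarith⟩
        · obtain ⟨y, hy, hgt0⟩ := habove
          exact ⟨y, by rw [hS1', hS1g]; exact hy, by rw [hval' y (hS1g ▸ hy), hvalg y hy]; linarith⟩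
      · rcases hε with rfl | rfl
        · obtain ⟨y, hy, hgt0⟩ := habove
          exact ⟨y, by rw [hS1', hS1g]; exact hy, by rw [hval' y (hS1g ▸ hy), hvalg y hy]; linarith⟩
        · obtain ⟨y, hy, hlt0⟩ := hbelow
          exact ⟨y, by rw [hS1', hS1g]; exact hy, by rw [hval' y (hS1g ▸ hy), hvalg y hy]; linarith⟩
  -- Step 1: the discs and the reflection
  obtain ⟨Dup, Dlow, hDupc, hDlowc, hUnion, hInter, hcUp, hcLow, hUpBox, hLowBox, hUpMem, hLowMem⟩ :=
    StepDiscs.exists_discs hC₁.emb hw₀ hη₀ hwall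
  obtain ⟨R, hRA, hRh, hR2, -, -, hRR⟩ := exists_reflection
  obtain ⟨hC₂, hNF₂, hh₂, hcritR, hS1R, hlevR⟩ := config_reflect hC₁ hNF R hRA hRh hR2 hRR
  obtain ⟨hDupc₂, hDlowc₂, hUnion₂, hInter₂, hcUp₂, hcLow₂, hUpBox₂, hLowBox₂, hUpMem₂, hLowMem₂⟩ :=
    discs_reflect R hRh hR2 hRR hDupc hDlowc hUnion hInter hcUp hcLow hUpBox hLowBox hUpMem hLowMem
  have hwall₂ := wall_of_tubeNF hC₂ hσ hNF₂
  have hRinj : Injective (R : EuclideanSpace ℝ (Fin 3) → EuclideanSpace ℝ (Fin 3)) := R.injective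
  have hval₂ : ∀ y, height (R ∘ (Θ ∘ f)) y = -height (Θ ∘ f) y := fun y => by rw [hh₂]
  have hinj₂ : InjOn (height (R ∘ (Θ ∘ f))) (criticalSet (𝓡 2) (height (R ∘ (Θ ∘ f)))) := by
    intro y₁ hy₁ y₂ hy₂ heq
    rw [hcritR] at hy₁ hy₂
    exact hinj₁ hy₁ hy₂ (by rw [hval₂, hval₂] at heq; linarith)
  have h0₂ : ∀ y, IsMCriticalPt (𝓡 2) (height (R ∘ (Θ ∘ f))) y → height (R ∘ (Θ ∘ f)) y ≠ 0 := fun y hy => by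
    have : y ∈ criticalSet (𝓡 2) (height (R ∘ (Θ ∘ f))) := hy
    rw [hcritR] at this
    rw [hval₂]; exact neg_ne_zero.2 (h0₁ y this)
  have hsad₂ : saddles (R ∘ (Θ ∘ f)) = n := by unfold saddles at hsad₁ ⊢; rw [hS1R]; exact hsad₁
  have hcomp₂ : {C : Set (EuclideanSpace ℝ (Fin 3)) | ∃ x ∈ range (R ∘ (Θ ∘ f)) ∩ {x | x 2 = 0},
      C = connectedComponentIn (range (R ∘ (Θ ∘ f)) ∩ {x | x 2 = 0}) x}.ncard =
      {C : Set (EuclideanSpace ℝ (Fin 3)) | ∃ x ∈ range f ∩ {x | x 2 = 0},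
        C = connectedComponentIn (range f ∩ {x | x 2 = 0}) x}.ncard := by
    rw [hlevR, ← hcomp₁]; exact SphereMoves.ncard_components_image R.toHomeomorph _
  -- the saddle counts over the two discs
  have hfin : (criticalSet (𝓡 2) (height (Θ ∘ f))).Finite := IsMorse.finite_criticalSet_holds hC₁.morse
  have hS1fin : (criticalSetOfIndex (𝓡 2) (height (Θ ∘ f)) 1).Finite := hfin.subset (criticalSetOfIndex_subset _ _ _)
  have hsplit : criticalSetOfIndex (𝓡 2) (height (Θ ∘ f)) 1 =
      {y | y ∈ criticalSetOfIndex (𝓡 2) (height (Θ ∘ f)) 1 ∧ (Θ ∘ f) y ∈ Dup} ∪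
        {y | y ∈ criticalSetOfIndex (𝓡 2) (height (Θ ∘ f)) 1 ∧ (Θ ∘ f) y ∈ Dlow} := by
    ext y; simp only [mem_union, mem_setOf_eq]
    constructor
    · intro hy
      have : (Θ ∘ f) y ∈ range (Θ ∘ f) := mem_range_self y
      rw [← hUnion] at this
      rcases this with h | h
      · exact Or.inl ⟨hy, h⟩
      · exact Or.inr ⟨hy, h⟩
    · rintro (⟨h, -⟩ | ⟨h, -⟩) <;> exact h
  have hdisj : Disjoint {y | y ∈ criticalSetOfIndex (𝓡 2) (height (Θ ∘ f)) 1 ∧ (Θ ∘ f) y ∈ Dup}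
      {y | y ∈ criticalSetOfIndex (𝓡 2) (height (Θ ∘ f)) 1 ∧ (Θ ∘ f) y ∈ Dlow} := by
    rw [Set.disjoint_left]
    rintro y ⟨hy, h1⟩ ⟨-, h2⟩
    have : (Θ ∘ f) y ∈ Dup ∩ Dlow := ⟨h1, h2⟩
    rw [hInter] at this
    exact h0₁ y hy.1 (by rw [height_apply]; exact this.2)
  have hsum := Set.ncard_union_eq hdisj (hS1fin.subset fun y hy => hy.1) (hS1fin.subset fun y hy => hy.1)
  rw [← hsplit] at hsum
  unfold saddles at hsad₁
  rw [hsad₁] at hsum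
  -- the saddles of the reflected sphere over the reflected discs
  have hkR : ∀ D : Set (EuclideanSpace ℝ (Fin 3)),
      {y | y ∈ criticalSetOfIndex (𝓡 2) (height (R ∘ (Θ ∘ f))) 1 ∧ (R ∘ (Θ ∘ f)) y ∈ R '' D} =
        {y | y ∈ criticalSetOfIndex (𝓡 2) (height (Θ ∘ f)) 1 ∧ (Θ ∘ f) y ∈ D} := fun D => by
    ext y; simp only [mem_setOf_eq, hS1R, Function.comp_apply, hRinj.mem_set_image]
  -- the extrema
  obtain ⟨yM, -, hyM⟩ := isCompact_univ.exists_isMaxOn (univ_nonempty) (hC₁.morse.contMDiff.continuous.continuousOn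
    (s := univ) (f := height (Θ ∘ f)))
  obtain ⟨ym, -, hym⟩ := isCompact_univ.exists_isMinOn (univ_nonempty) (hC₁.morse.contMDiff.continuous.continuousOn
    (s := univ) (f := height (Θ ∘ f)))
  have hyM₂ : IsMinOn (height (R ∘ (Θ ∘ f))) univ yM := fun y _ => by
    have := hyM (mem_univ y); simp only [mem_setOf_eq] at this ⊢; rw [hval₂, hval₂]; linarith
  have hym₂ : IsMaxOn (height (R ∘ (Θ ∘ f))) univ ym := fun y _ => by
    have := hym (mem_univ y); simp only [mem_setOf_eq] at this ⊢; rw [hval₂, hval₂]; linarith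
  have hMmem : (Θ ∘ f) yM ∈ Dup ∨ (Θ ∘ f) yM ∈ Dlow := by
    have : (Θ ∘ f) yM ∈ range (Θ ∘ f) := mem_range_self _
    rw [← hUnion] at this; exact this
  have hmmem : (Θ ∘ f) ym ∈ Dup ∨ (Θ ∘ f) ym ∈ Dlow := by
    have : (Θ ∘ f) ym ∈ range (Θ ∘ f) := mem_range_self _
    rw [← hUnion] at this; exact this
  -- Step 2: the orientation test
  by_cases hA : {y | y ∈ criticalSetOfIndex (𝓡 2) (height (Θ ∘ f)) 1 ∧ (Θ ∘ f) y ∈ Dlow}.ncard < n ∧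
      ((Θ ∘ f) yM ∈ Dup ∨ (Θ ∘ f) ym ∈ Dup)
  · -- absorb `D₋` as is
    have hext0 : (∃ y₀, IsMaxOn (height (Θ ∘ f)) univ y₀ ∧ (Θ ∘ f) y₀ ∈ Dup) ∨
        (∃ y₀, IsMinOn (height (Θ ∘ f)) univ y₀ ∧ (Θ ∘ f) y₀ ∈ Dup) := by
      rcases hA.2 with h | h
      · exact Or.inl ⟨yM, hyM, h⟩
      · exact Or.inr ⟨ym, hym, h⟩
    obtain ⟨F', f', hres⟩ := step_oriented IH hC₁ hσ hw₀ hη₀ hNF hDupc hDlowc hUnion hInter hcUp hUpBox hLowBox hUpMem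
      hinj₁ h0₁ (by unfold saddles; exact hsad₁) hA.1 hext0
    exact pull F' f' (Θ ∘ f) 1 (Or.inl rfl) hS1₁ (fun y hy => by rw [one_mul]; exact hval₁ y hy.1) hcomp₁
      (fun h => exists_ball_of_diffeomorph_comp Θ h) hres
  by_cases hB : {y | y ∈ criticalSetOfIndex (𝓡 2) (height (Θ ∘ f)) 1 ∧ (Θ ∘ f) y ∈ Dup}.ncard < n ∧
      ((Θ ∘ f) yM ∈ Dlow ∨ (Θ ∘ f) ym ∈ Dlow)
  · -- reflect, then absorb the former `D₊`
    have hkL₂ : {y | y ∈ criticalSetOfIndex (𝓡 2) (height (R ∘ (Θ ∘ f))) 1 ∧ (R ∘ (Θ ∘ f)) y ∈ R '' Dup}.ncard < n := by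
      rw [hkR]; exact hB.1
    have hext0 : (∃ y₀, IsMaxOn (height (R ∘ (Θ ∘ f))) univ y₀ ∧ (R ∘ (Θ ∘ f)) y₀ ∈ R '' Dlow) ∨
        (∃ y₀, IsMinOn (height (R ∘ (Θ ∘ f))) univ y₀ ∧ (R ∘ (Θ ∘ f)) y₀ ∈ R '' Dlow) := by
      rcases hB.2 with h | h
      · exact Or.inr ⟨yM, hyM₂, by simp only [Function.comp_apply, hRinj.mem_set_image]; exact h⟩
      · exact Or.inl ⟨ym, hym₂, by simp only [Function.comp_apply, hRinj.mem_set_image]; exact h⟩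
    obtain ⟨F', f', hres⟩ := step_oriented IH hC₂ hσ hw₀ hη₀ hNF₂ hDupc₂ hDlowc₂ hUnion₂ hInter₂ hcUp₂ hUpBox₂ hLowBox₂
      hUpMem₂ hinj₂ h0₂ hsad₂ hkL₂ hext0
    refine pull F' f' (R ∘ (Θ ∘ f)) (-1) (Or.inr rfl) (hS1R.trans hS1₁)
      (fun y hy => by rw [hval₂, hval₁ y hy.1]; ring) hcomp₂ (fun h => ?_) hres
    exact exists_ball_of_diffeomorph_comp Θ (exists_ball_of_diffeomorph_comp R h)
  -- the remaining labellings are impossible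
  exfalso
  have hfinΛ : (height (Θ ∘ f) '' criticalSet (𝓡 2) (height (Θ ∘ f))).Finite := hfin.image _
  have hE₂ : Dlow ⊆ range (Θ ∘ f) := fun x hx => hUnion ▸ Or.inr hx
  rcases em ((Θ ∘ f) yM ∈ Dup ∨ (Θ ∘ f) ym ∈ Dup) with hUp | hnotUp
  · -- then all saddles lie over `D₋`, none over `D₊`, and both extrema lie over `D₊`: reflect
    have hkL : ¬ {y | y ∈ criticalSetOfIndex (𝓡 2) (height (Θ ∘ f)) 1 ∧ (Θ ∘ f) y ∈ Dlow}.ncard < n := fun h => hA ⟨h, hUp⟩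
    have hkU0 : {y | y ∈ criticalSetOfIndex (𝓡 2) (height (Θ ∘ f)) 1 ∧ (Θ ∘ f) y ∈ Dup}.ncard = 0 := by omega
    have hkUlt : {y | y ∈ criticalSetOfIndex (𝓡 2) (height (Θ ∘ f)) 1 ∧ (Θ ∘ f) y ∈ Dup}.ncard < n := by omega
    have hnotLow : ¬ ((Θ ∘ f) yM ∈ Dlow ∨ (Θ ∘ f) ym ∈ Dlow) := fun h => hB ⟨hkUlt, h⟩
    push Not at hnotLow
    have hMU : (Θ ∘ f) yM ∈ Dup := hMmem.resolve_right hnotLow.1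
    have hmU : (Θ ∘ f) ym ∈ Dup := hmmem.resolve_right hnotLow.2
    have hempty : {y | y ∈ criticalSetOfIndex (𝓡 2) (height (Θ ∘ f)) 1 ∧ (Θ ∘ f) y ∈ Dup} = ∅ :=
      (Set.ncard_eq_zero (hS1fin.subset fun y hy => hy.1)).1 hkU0
    -- data of the step for the reflected sphere, absorbing `R D₊`
    obtain ⟨P, s, δ, ε₁, R₁, FX, T₀, Φ, fB, hP, hN, hS, -, -, -, hfZ, -, -, -, -, -, -, -, -, hfB, hWB⟩ :=
      exists_stepData hC₂ hσ hw₀ hη₀ hNF₂ hDupc₂ hDlowc₂ hUnion₂ hInter₂ hUpBox₂ hLowBox₂ (Λ := ∅) Set.finite_empty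
    have hnos : ∀ y' ∈ criticalSetOfIndex (𝓡 2) (height (R ∘ (Θ ∘ f))) 1, (R ∘ (Θ ∘ f)) y' ∉ R '' Dup := by
      intro y' hy' hmem
      have : y' ∈ ({y | y ∈ criticalSetOfIndex (𝓡 2) (height (R ∘ (Θ ∘ f))) 1 ∧ (R ∘ (Θ ∘ f)) y ∈ R '' Dup} : Set _) :=
        ⟨hy', hmem⟩
      rw [hkR, hempty] at this; exact this
    refine false_of_extrema_over_absorbed hP hN hS hC₂.emb hfZ (fun x hx => hUnion₂ ▸ Or.inr hx) hfB hWB hC₂.morse hnos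
      (yM := ym) (ym := yM) hym₂ ?_ ?_ hyM₂ ?_ ?_
    · simp only [Function.comp_apply, hRinj.mem_set_image]; exact hmU
    · rw [hval₂]; have := height_le_neg_eta_of_isMinOn hw₀ hη₀ hwall hym; linarith
    · simp only [Function.comp_apply, hRinj.mem_set_image]; exact hMU
    · rw [hval₂]; have := eta_le_height_of_isMaxOn hw₀ hη₀ hwall hyM; linarith
  · -- both extrema lie over `D₋` and all saddles over `D₊`
    push Not at hnotUp
    have hML : (Θ ∘ f) yM ∈ Dlow := hMmem.resolve_left hnotUp.1
    have hmL : (Θ ∘ f) ym ∈ Dlow := hmmem.resolve_left hnotUp.2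
    have hkU : ¬ {y | y ∈ criticalSetOfIndex (𝓡 2) (height (Θ ∘ f)) 1 ∧ (Θ ∘ f) y ∈ Dup}.ncard < n :=
      fun h => hB ⟨h, Or.inl hML⟩
    have hkL0 : {y | y ∈ criticalSetOfIndex (𝓡 2) (height (Θ ∘ f)) 1 ∧ (Θ ∘ f) y ∈ Dlow}.ncard = 0 := by omega
    have hempty : {y | y ∈ criticalSetOfIndex (𝓡 2) (height (Θ ∘ f)) 1 ∧ (Θ ∘ f) y ∈ Dlow} = ∅ :=
      (Set.ncard_eq_zero (hS1fin.subset fun y hy => hy.1)).1 hkL0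
    obtain ⟨P, s, δ, ε₁, R₁, FX, T₀, Φ, fB, hP, hN, hS, -, -, -, hfZ, -, -, -, -, -, -, -, -, hfB, hWB⟩ :=
      exists_stepData hC₁ hσ hw₀ hη₀ hNF hDupc hDlowc hUnion hInter hUpBox hLowBox (Λ := ∅) Set.finite_empty
    have hnos : ∀ y' ∈ criticalSetOfIndex (𝓡 2) (height (Θ ∘ f)) 1, (Θ ∘ f) y' ∉ Dlow := by
      intro y' hy' hmem
      have : y' ∈ ({y | y ∈ criticalSetOfIndex (𝓡 2) (height (Θ ∘ f)) 1 ∧ (Θ ∘ f) y ∈ Dlow} : Set _) := ⟨hy', hmem⟩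
      rw [hempty] at this; exact this
    exact false_of_extrema_over_absorbed hP hN hS hC₁.emb hfZ hE₂ hfB hWB hC₁.morse hnos hyM hML
      (eta_le_height_of_isMaxOn hw₀ hη₀ hwall hyM) hym hmL (height_le_neg_eta_of_isMinOn hw₀ hη₀ hwall hym)

end Step

/-! ### §3 The double induction -/

/-- The unit sphere `𝕊² ⊆ ℝ³` is connected. [folklore] -/
theorem connectedSpace_sphere_two : ConnectedSpace (sphere (0 : EuclideanSpace ℝ (Fin 3)) 1) := by
  haveI : Fact (finrank ℝ (EuclideanSpace ℝ (Fin 3)) = 2 + 1) := ⟨finrank_euclideanSpace_fin⟩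
  refine isConnected_iff_connectedSpace.mp (isConnected_sphere ?_ 0 zero_le_one)
  rw [← Module.finrank_eq_rank, finrank_euclideanSpace_fin]
  norm_num

set_option maxHeartbeats 1600000 in
/-- **The inner induction** on the number of level circles at height `0`, for configurations
with `n` saddles lying on both sides of the plane `{x₂ = 0}` (Schultens' "plane `H'` … such that
there are saddle points both above and below `H'`", PDF p. 44), given the theorem below `n`.
[cite: Schultens2014, proof of Thm. 3.2.5 (PDF pp. 44–45)] -/
theorem exists_ball_of_level {n : ℕ} (hn : 1 ≤ n)
    (IH : ∀ (F' : EuclideanSpace ℝ (Fin 3) → ℝ) (f' : sphere (0 : EuclideanSpace ℝ (Fin 3)) 1 → EuclideanSpace ℝ (Fin 3)),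
      Config F' f' → InjOn (height f') (criticalSet (𝓡 2) (height f')) → saddles f' < n →
        ∃ e : EuclideanSpace ℝ (Fin 3) → EuclideanSpace ℝ (Fin 3),
          Manifold.IsSmoothEmbedding 𝓘(ℝ, EuclideanSpace ℝ (Fin 3)) 𝓘(ℝ, EuclideanSpace ℝ (Fin 3)) ∞ e ∧
            e '' sphere 0 1 = range f') :
    ∀ (c : ℕ) (F : EuclideanSpace ℝ (Fin 3) → ℝ) (f : sphere (0 : EuclideanSpace ℝ (Fin 3)) 1 → EuclideanSpace ℝ (Fin 3)),
      Config F f → InjOn (height f) (criticalSet (𝓡 2) (height f)) →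
      (∀ y, IsMCriticalPt (𝓡 2) (height f) y → height f y ≠ 0) → saddles f = n →
      (∃ y ∈ criticalSetOfIndex (𝓡 2) (height f) 1, height f y < 0) →
      (∃ y ∈ criticalSetOfIndex (𝓡 2) (height f) 1, 0 < height f y) →
      {C : Set (EuclideanSpace ℝ (Fin 3)) | ∃ x ∈ range f ∩ {x | x 2 = 0},
          C = connectedComponentIn (range f ∩ {x | x 2 = 0}) x}.ncard = c →
      ∃ e : EuclideanSpace ℝ (Fin 3) → EuclideanSpace ℝ (Fin 3),
        Manifold.IsSmoothEmbedding 𝓘(ℝ, EuclideanSpace ℝ (Fin 3)) 𝓘(ℝ, EuclideanSpace ℝ (Fin 3)) ∞ e ∧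
          e '' sphere 0 1 = range f := by
  intro c
  induction c using Nat.strong_induction_on with
  | _ c IHc =>
    intro F f hC hinj h0 hsad hbelow habove hc
    haveI := connectedSpace_sphere_two
    -- the sphere meets the plane
    have hne : ∃ y, height f y = 0 := by
      obtain ⟨y₁, -, hy₁⟩ := hbelow
      obtain ⟨y₂, -, hy₂⟩ := habove
      have := intermediate_value_univ y₁ y₂ hC.morse.contMDiff.continuous ⟨hy₁.le, hy₂.le⟩
      exact this
    obtain ⟨F', f', hC', hinj', h0', hred, hdich⟩ := step hn IH hC hinj h0 hne hsad hbelow habove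
    apply hred
    rcases hdich with hlt | ⟨hsad', hbelow', habove', hclt⟩
    · exact IH F' f' hC' hinj' hlt
    · exact IHc _ (hc ▸ hclt) F' f' hC' hinj' h0' hsad' hbelow' habove' rfl

set_option maxHeartbeats 1600000 in
/-- **Alexander's theorem for configurations** (the outer induction on the number of saddles,
Schultens (2014), proof of Thm. 3.2.5): for every configuration whose height is injective on
its critical set, the sphere is the image of the unit sphere under a smooth embedding
`ℝ³ → ℝ³`.  Base `n ≤ 1`: `ExpHeight.exists_isSmoothEmbedding_image_sphere_of_ncard_index_one_le_one`;
step `n ≥ 2`: translate a regular level between two saddle values to height `0`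
(`HeightFunction.exists_regular_level_between_nonempty`) and run the inner induction.
[cite: Schultens2014, Thm. 3.2.5 and proof (PDF pp. 43–45)] -/
theorem exists_ball_of_config :
    ∀ (n : ℕ) (F : EuclideanSpace ℝ (Fin 3) → ℝ) (f : sphere (0 : EuclideanSpace ℝ (Fin 3)) 1 → EuclideanSpace ℝ (Fin 3)),
      Config F f → InjOn (height f) (criticalSet (𝓡 2) (height f)) → saddles f = n →
      ∃ e : EuclideanSpace ℝ (Fin 3) → EuclideanSpace ℝ (Fin 3),
        Manifold.IsSmoothEmbedding 𝓘(ℝ, EuclideanSpace ℝ (Fin 3)) 𝓘(ℝ, EuclideanSpace ℝ (Fin 3)) ∞ e ∧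
          e '' sphere 0 1 = range f := by
  intro n
  induction n using Nat.strong_induction_on with
  | _ n IHn =>
    intro F f hC hinj hsad
    haveI := connectedSpace_sphere_two
    by_cases hn : n ≤ 1
    · -- base: at most one saddle
      exact ExpHeight.exists_isSmoothEmbedding_image_sphere_of_ncard_index_one_le_one hC.emb e₂_ne_zero
        (by rw [← height_eq]; exact hC.morse) (by rw [← height_eq]; unfold saddles at hsad; omega)
    · -- two saddles at distinct heights, a regular level between them, translated to height `0`
      push Not at hn
      have hfin : (criticalSet (𝓡 2) (height f)).Finite := IsMorse.finite_criticalSet_holds hC.morse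
      have hS1fin : (criticalSetOfIndex (𝓡 2) (height f) 1).Finite := hfin.subset (criticalSetOfIndex_subset _ _ _)
      obtain ⟨p, hp, q, hq, hpq⟩ := (Set.one_lt_ncard hS1fin).1 (by unfold saddles at hsad; omega)
      -- order them by height
      obtain ⟨p, hp, q, hq, hpq, hle⟩ : ∃ p ∈ criticalSetOfIndex (𝓡 2) (height f) 1, ∃ q ∈ criticalSetOfIndex (𝓡 2) (height f) 1,
          p ≠ q ∧ height f p ≤ height f q := by
        rcases le_total (height f p) (height f q) with h | h
        · exact ⟨p, hp, q, hq, hpq, h⟩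
        · exact ⟨q, hq, p, hp, hpq.symm, h⟩
      obtain ⟨r, hr, hpr, hrq, -⟩ :=
        HeightFunction.exists_regular_level_between_nonempty hC.morse hinj hp.1 hq.1 hpq hle
      obtain ⟨T, hTA, -⟩ := exists_translation (-r)
      have hCT : Config (F ∘ T.symm) (T ∘ f) := hC.transport T hTA
      have hhT : height (T ∘ f) = fun y => 1 * height f y + -r := height_comp_eq T hTA
      have hcritT : criticalSet (𝓡 2) (height (T ∘ f)) = criticalSet (𝓡 2) (height f) := by
        rw [hhT]; exact criticalSet_const_mul_add one_ne_zero _ (hC.morse.contMDiff.mdifferentiable (by simp))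
      have hS1T : criticalSetOfIndex (𝓡 2) (height (T ∘ f)) 1 = criticalSetOfIndex (𝓡 2) (height f) 1 := by
        rw [hhT]; exact (isMorse_affine hC.morse (Or.inl rfl) (-r)).2
      have hvalT : ∀ y, height (T ∘ f) y = height f y - r := fun y => by rw [hhT]; ring
      have hinjT : InjOn (height (T ∘ f)) (criticalSet (𝓡 2) (height (T ∘ f))) := by
        intro y₁ hy₁ y₂ hy₂ heq
        rw [hcritT] at hy₁ hy₂
        exact hinj hy₁ hy₂ (by rw [hvalT, hvalT] at heq; linarith)
      have h0T : ∀ y, IsMCriticalPt (𝓡 2) (height (T ∘ f)) y → height (T ∘ f) y ≠ 0 := by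
        intro y hy
        have hy' : y ∈ criticalSet (𝓡 2) (height (T ∘ f)) := hy
        rw [hcritT] at hy'
        rw [hvalT]; exact sub_ne_zero.2 (hr y hy')
      have hsadT : saddles (T ∘ f) = n := by rw [saddles_transport (F := F) T hC hTA]; exact hsad
      have hbelow : ∃ y ∈ criticalSetOfIndex (𝓡 2) (height (T ∘ f)) 1, height (T ∘ f) y < 0 :=
        ⟨p, by rw [hS1T]; exact hp, by rw [hvalT]; linarith⟩
      have habove : ∃ y ∈ criticalSetOfIndex (𝓡 2) (height (T ∘ f)) 1, 0 < height (T ∘ f) y :=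
        ⟨q, by rw [hS1T]; exact hq, by rw [hvalT]; linarith⟩
      have h1n : 1 ≤ n := by omega
      have := exists_ball_of_level h1n (fun F' f' hC' hinj' hlt => IHn _ hlt F' f' hC' hinj' rfl) _ (F ∘ T.symm) (T ∘ f)
        hCT hinjT h0T hsadT hbelow habove rfl
      exact exists_ball_of_diffeomorph_comp T this

/-! ### §4 Alexander's theorem -/

/-- **Alexander's theorem / the smooth Schönflies theorem in `ℝ³`** (Schultens (2014),
Thm. 3.2.5: "any 2-sphere in `ℝ³` bounds a 3-ball"): every smoothly embedded sphere
`f : 𝕊² → ℝ³` is the image of the unit sphere under a smooth embedding `e : ℝ³ → ℝ³` (so it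
bounds the smooth ball `e(𝔻³)`).  A generic direction `v` near `e₂` gives a Morse height
injective on its critical set (`HeightFunction.exists_mem_isMorse_and_injOn_height_sphere`); the
linear shear `x ↦ (x₀, x₁, ⟪v, x⟫)` makes it the vertical height of a configuration
(`SchoenfliesStep.exists_config_of_isMorse`), and `exists_ball_of_config` applies.
[cite: Schultens2014, Thm. 3.2.5 (PDF p. 43)] -/
theorem exists_ball_euclidean {f : sphere (0 : EuclideanSpace ℝ (Fin 3)) 1 → EuclideanSpace ℝ (Fin 3)}
    (hf : Manifold.IsSmoothEmbedding (𝓡 2) 𝓘(ℝ, EuclideanSpace ℝ (Fin 3)) ∞ f) :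
    ∃ e : EuclideanSpace ℝ (Fin 3) → EuclideanSpace ℝ (Fin 3),
      Manifold.IsSmoothEmbedding 𝓘(ℝ, EuclideanSpace ℝ (Fin 3)) 𝓘(ℝ, EuclideanSpace ℝ (Fin 3)) ∞ e ∧
        e '' sphere 0 1 = range f := by
  -- a generic direction near `e₂`
  obtain ⟨v, hv, hMorse, hinj⟩ := HeightFunction.exists_mem_isMorse_and_injOn_height_sphere hf
    (U := ball (EuclideanSpace.single (2 : Fin 3) (1 : ℝ)) (1 / 2)) isOpen_ball ⟨_, mem_ball_self (by norm_num)⟩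
  have hv2 : 1 / 2 < v 2 := by
    rw [mem_ball, dist_eq_norm] at hv
    have h : |(v - EuclideanSpace.single (2 : Fin 3) (1 : ℝ)) 2| ≤ ‖v - EuclideanSpace.single (2 : Fin 3) (1 : ℝ)‖ := by
      simpa [Real.norm_eq_abs] using PiLp.norm_apply_le (v - EuclideanSpace.single (2 : Fin 3) (1 : ℝ)) 2
    have h' : (v - EuclideanSpace.single (2 : Fin 3) (1 : ℝ)) 2 = v 2 - 1 := by simp
    rw [h'] at h
    have := (abs_lt.1 (lt_of_le_of_lt h hv)).1
    linarith
  have hv20 : v 2 ≠ 0 := by linarith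
  -- the shear `L x = x + (⟪v, x⟫ - x₂) e₂`, with `(L x)₂ = ⟪v, x⟫`
  set e2 : EuclideanSpace ℝ (Fin 3) := EuclideanSpace.single (2 : Fin 3) (1 : ℝ) with he2
  set L : EuclideanSpace ℝ (Fin 3) →L[ℝ] EuclideanSpace ℝ (Fin 3) :=
    ContinuousLinearMap.id ℝ _ + (innerSL ℝ v - innerSL ℝ e2).smulRight e2 with hL
  set Linv : EuclideanSpace ℝ (Fin 3) →L[ℝ] EuclideanSpace ℝ (Fin 3) :=
    ContinuousLinearMap.id ℝ _ - (v 2)⁻¹ • (innerSL ℝ v - innerSL ℝ e2).smulRight e2 with hLinv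
  have hLapply : ∀ x, L x = x + (⟪v, x⟫ - x 2) • e2 := fun x => by
    simp [hL, ContinuousLinearMap.smulRight_apply, he2, EuclideanSpace.inner_single_left]
  have hLinvapply : ∀ x, Linv x = x - ((v 2)⁻¹ * (⟪v, x⟫ - x 2)) • e2 := fun x => by
    simp [hLinv, ContinuousLinearMap.smulRight_apply, he2, EuclideanSpace.inner_single_left, smul_smul]
  have hL2 : ∀ x, (L x) 2 = ⟪v, x⟫ := fun x => by rw [hLapply]; simp [he2]
  have hve2 : ⟪v, e2⟫ = v 2 := by simp [he2, EuclideanSpace.inner_single_right]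
  have hLL : ∀ x, Linv (L x) = x := fun x => by
    rw [hLinvapply, hLapply]
    simp only [inner_add_right, inner_smul_right, hve2]
    have h2 : (x + (⟪v, x⟫ - x 2) • e2) 2 = ⟪v, x⟫ := by simp [he2]
    rw [h2]
    have : (v 2)⁻¹ * (⟪v, x⟫ + (⟪v, x⟫ - x 2) * v 2 - ⟪v, x⟫) = ⟪v, x⟫ - x 2 := by field_simp; ring
    rw [this]; abel
  have hLL' : ∀ x, L (Linv x) = x := fun x => by
    rw [hLinvapply, hLapply]
    simp only [inner_sub_right, inner_smul_right, hve2]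
    have h2 : (x - ((v 2)⁻¹ * (⟪v, x⟫ - x 2)) • e2) 2 = x 2 - (v 2)⁻¹ * (⟪v, x⟫ - x 2) := by simp [he2]
    rw [h2]
    have : ⟪v, x⟫ - (v 2)⁻¹ * (⟪v, x⟫ - x 2) * v 2 - (x 2 - (v 2)⁻¹ * (⟪v, x⟫ - x 2)) =
        (v 2)⁻¹ * (⟪v, x⟫ - x 2) := by field_simp; ring
    rw [this]; abel
  set Le : EuclideanSpace ℝ (Fin 3) ≃L[ℝ] EuclideanSpace ℝ (Fin 3) :=
    ContinuousLinearEquiv.equivOfInverse L Linv hLL hLL' with hLe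
  have hLe_apply : ∀ x, Le x = L x := fun x => rfl
  -- the sheared sphere is a configuration with Morse height `⟪v, f ·⟫`
  have hheight : height (Le.toDiffeomorph ∘ f) = fun y => ⟪v, f y⟫ := by
    funext y
    rw [height_apply, Function.comp_apply, ContinuousLinearEquiv.coe_toDiffeomorph, hLe_apply, hL2]
  have hf' : Manifold.IsSmoothEmbedding (𝓡 2) 𝓘(ℝ, EuclideanSpace ℝ (Fin 3)) ∞ (Le.toDiffeomorph ∘ f) :=
    hf.diffeomorph_comp Le.toDiffeomorph
  have hMorse' : IsMorse (𝓡 2) (height (Le.toDiffeomorph ∘ f)) := by rw [hheight]; exact hMorse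
  have hinj' : InjOn (height (Le.toDiffeomorph ∘ f)) (criticalSet (𝓡 2) (height (Le.toDiffeomorph ∘ f))) := by
    rw [hheight]; exact hinj
  obtain ⟨F, hC⟩ := exists_config_of_isMorse hf' hMorse'
  exact exists_ball_of_diffeomorph_comp Le.toDiffeomorph (exists_ball_of_config _ F _ hC hinj' rfl)

end Literature.Topology.FourManifolds.SchoenfliesInduction

namespace Literature.Topology.FourManifolds.SphereEmbedding

/-- **Alexander's theorem (the Schönflies theorem in `S³`) holds**: discharge of the named fact
`SphereEmbedding.schoenflies_exists_ball` of `SchoenfliesSphereThree.lean` — for every smoothly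
embedded 2-sphere `S ⊆ 𝕊³` and every point `p ∉ S`, the side of `S` away from `p` is a smoothly
embedded closed 3-ball.  By `schoenflies_exists_ball_of_euclidean` (Schultens' Cor. 3.2.6 and the
remark after it, proved in `SchoenfliesSphereThreeProofs.lean`) it suffices to know Thm. 3.2.5 in
`ℝ³` in the form `SchoenfliesInduction.exists_ball_euclidean`.
[cite: Schultens2014, Thm. 3.2.5 (PDF p. 43) with Cor. 3.2.6 and remark (PDF p. 45)] -/
theorem schoenflies_exists_ball_holds : schoenflies_exists_ball :=
  schoenflies_exists_ball_of_euclidean fun _ hf => SchoenfliesInduction.exists_ball_euclidean hf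

end Literature.Topology.FourManifolds.SphereEmbedding
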